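import Summits.BirchSwinnertonDyer.BirchSwinnertonDyer.Theorems.ManinLocalTwoThreeKummerDiamondDescentDictionary
import Summits.BirchSwinnertonDyer.BirchSwinnertonDyer.Theorems.ManinLocalTwoThreeKummerDiamondHalvingCocycle
import Summits.BirchSwinnertonDyer.BirchSwinnertonDyer.Theorems.ManinLocalTwoThreeKummerDiamondKummerSubgroup
import Summits.BirchSwinnertonDyer.Rank1Residual.ManinAdditive.KummerDiamondReciprocity
import Summits.BirchSwinnertonDyer.BirchSwinnertonDyer.Theorems.ManinLocalTwoThreeKummerDiamondDescentCases
import Summits.BirchSwinnertonDyer.BirchSwinnertonDyer.Theorems.ManinLocalTwoThreeTwoTorsionLegendreNormalForm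
import Summits.BirchSwinnertonDyer.BirchSwinnertonDyer.Theorems.ManinLocalTwoThreeIndexFourSplitTwoTorsion
import Summits.BirchSwinnertonDyer.Rank1Residual.ManinAdditive.KummerDiamondCuspRationality
import HarnessLib

/-!
# E-es-185 `IndexFourForcesFreyTwistShape` as a theorem modulo the four PRINTED facts F★, CES, T-es-75 and the X₀ cusp fact
# (the hardest stub of the LEAD line `kummer_diamond`, crux C2 `ManinOddAtFour`)
(route `ManinLocalTwoThree`, crux C2 `ManinOddAtFour` stmt-BirchSwinnertonDyer-22967; cell bsd-f2-manin, C2/C3 LEAD p1 gen 20;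
`--supports stmt-BirchSwinnertonDyer-22967`; line card `Cruxes/ManinOddAtFour/Lines/kummer_diamond.md`, D1–D9 assembled)

ASSEMBLY of es's proof of E-es-185 (MEMO-es §59.5, referee ref1 §R215) from the cell's kernel theorems:
D1 full rational `2`-torsion (p2 `exists_three_rationalTwoTorsionX_of_index_four`, ⟸ F★ ∧ CES), D3 rationality of the Atkin–Lehner points (es/ty
`uniformize_modularSymbol_inv_unitary_rational`, ⟸ the X₀ cusp fact), Manin–Drinfeld torsion (LEAD `isOfFinAddOrder_uniformize_mul_modularSymbol`),
D4 the halving cocycles (LEAD `exists_halvingCocycle_T₁/T₂`), D5 THEOREM K + D6 PROPOSITION A (es `indexFour_kummerDiamondReciprocity` ⟸ T-es-75 ∧ CES,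
p2 `propositionA_complex`), the D6→D7 dictionary (LEAD `reading_of_h₁/h₂`, Kummer witnesses `√2, i, i√2, g_p`), D7 (LEAD
`hasFreyTwistShape_of_legendre_descent_cases`) and the Legendre normal form (p2 `exists_variableChange_eq_legendre`):

* `twoTorsion_eq_fourSet_of_index_four` — in the index-`4` world `W₀(ℂ)[2] = {0, T₁, T₂, T₃}` with `Tᵢ = (eᵢ, ·)`, `e₁ < e₂ < e₃` rational
  (no `4 ∣ N` hypothesis), hence every `2`-torsion point is fixed by `Aut(ℂ/ℚ)`;
* **`indexFourForcesFreyTwistShape_of_printedFacts : F★ → CES → T-es-75 → optimalParametrization_cusp_cyclotomic_galois →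
  IndexFourForcesFreyTwistShape`**.

HONEST FRAMING: CONDITIONAL on four statement-only PRINTED facts — F★ `optimalGamma1Parametrization_cusp_rational` (Stevens 1982 Thm 1.3.1(a)),
CES `exists_optimal_gamma1ParametrizationData` (Conrad–Edixhoven–Stein 2003), T-es-75 `optimalGamma1Parametrization_cuspInv_galoisAction`
(Stevens 1982 Thm 1.3.1(b)) and `optimalParametrization_cusp_cyclotomic_galois` (Stevens 1982 Thm 1.3.1 for `X₀(N)`); with CDT Thm 1.0.1 this closes
C2 only CONDITIONALLY.  Nothing about Manin's conjecture or BSD is proved here.  No definitions, no sorry.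
[cite: Stevens1982, §1.3 Thm. 1.3.1] [cite: Stevens1989, §2] [cite: ConradEdixhovenStein2003, §6.1.2 and Lemma 6.1.6] [cite: SilvermanAEC2009, Prop. X.1.4]
-/

set_option autoImplicit false
-- lint-debt: the directory name repeats the summit name (sibling precedent `ManinLocalTwoThreeKummerDiamondStepTwoAssembly.lean`)
set_option linter.dupNamespace false

noncomputable section

open scoped Classical MatrixGroups
open Complex CongruenceSubgroup WeierstrassCurve WeierstrassCurve.Affine WeierstrassCurve.Affine.Point
open Literature.NumberTheory.EllipticCurves Literature.NumberTheory.EllipticCurves.ModularForms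
open Literature.NumberTheory.EllipticCurves.Greenberg1999
open Summit.BirchSwinnertonDyer.Rank1Residual.ManinAdditive.KummerDiamond

namespace Summit.BirchSwinnertonDyer.BirchSwinnertonDyer.Theorems.ManinLocalTwoThree.KummerDiamondIndexFour

variable {W₀ : WeierstrassCurve ℚ} [W₀.IsElliptic] {N : ℕ} [NeZero N]

/-! ## §1 Sorting three rational roots -/

omit [W₀.IsElliptic] in
/-- Three pairwise distinct rational `2`-torsion abscissae can be listed increasingly. [folklore] -/
theorem exists_sorted_twoTorsionX {x₁ x₂ x₃ : ℚ} (h12 : x₁ ≠ x₂) (h13 : x₁ ≠ x₃) (h23 : x₂ ≠ x₃)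
    (h₁ : HasRationalTwoTorsionX W₀ x₁) (h₂ : HasRationalTwoTorsionX W₀ x₂) (h₃ : HasRationalTwoTorsionX W₀ x₃) :
    ∃ e₁ e₂ e₃ : ℚ, e₁ < e₂ ∧ e₂ < e₃ ∧
      HasRationalTwoTorsionX W₀ e₁ ∧ HasRationalTwoTorsionX W₀ e₂ ∧ HasRationalTwoTorsionX W₀ e₃ := by
  rcases lt_or_gt_of_ne h12 with a | a <;> rcases lt_or_gt_of_ne h13 with b | b <;> rcases lt_or_gt_of_ne h23 with c | c
  · exact ⟨x₁, x₂, x₃, a, c, h₁, h₂, h₃⟩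
  · exact ⟨x₁, x₃, x₂, b, c, h₁, h₃, h₂⟩
  · exact absurd (a.trans c) (lt_asymm b)
  · exact ⟨x₃, x₁, x₂, b, a, h₃, h₁, h₂⟩
  · exact ⟨x₂, x₁, x₃, a, b, h₂, h₁, h₃⟩
  · exact absurd (b.trans c) (lt_asymm a)
  · exact ⟨x₂, x₃, x₁, c, b, h₂, h₃, h₁⟩
  · exact ⟨x₃, x₂, x₁, c, a, h₃, h₂, h₁⟩

/-! ## §2 The `2`-torsion of `W₀(ℂ)` is `{0, T₁, T₂, T₃}`, all fixed by `Aut(ℂ/ℚ)` -/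

omit [W₀.IsElliptic] in
/-- Points with equal coordinates are equal. [folklore] -/
theorem some_congr' {x y x' y' : ℂ} (h : (W₀.baseChange ℂ).toAffine.Nonsingular x y) (h' : (W₀.baseChange ℂ).toAffine.Nonsingular x' y')
    (hx : x = x') (hy : y = y') : (Affine.Point.some _ _ h : (W₀.baseChange ℂ).toAffine.Point) = Affine.Point.some _ _ h' := by
  subst hx hy; rfl

/-- A rational `2`-torsion point `(e, −(a₁e + a₃)/2)` over `ℂ` is fixed by every `σ ∈ Aut(ℂ/ℚ)`. [folklore] -/
theorem map_twoTorsionPoint {e₁ e₂ e₃ : ℚ} (hC : (W₀.baseChange ℂ).toAffine.SplitTwoTorsion (e₁ : ℂ) (e₂ : ℂ) (e₃ : ℂ)) (σ : ℂ ≃ₐ[ℚ] ℂ) :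
    Affine.Point.map (W' := W₀) (σ : ℂ →ₐ[ℚ] ℂ) (.some _ _ (nonsingular_twoTorsion hC)) = .some _ _ (nonsingular_twoTorsion hC) := by
  rw [Affine.Point.map_some]
  refine some_congr' _ _ (by simp) ?_
  have ha₁ : (W₀.baseChange ℂ).toAffine.a₁ = (W₀.a₁ : ℂ) := by simp [WeierstrassCurve.baseChange, WeierstrassCurve.map_a₁]
  have ha₃ : (W₀.baseChange ℂ).toAffine.a₃ = (W₀.a₃ : ℂ) := by simp [WeierstrassCurve.baseChange, WeierstrassCurve.map_a₃]
  simp only [twoTorsionY, ha₁, ha₃, map_div₀, map_neg, map_add, map_mul, map_ofNat, map_ratCast]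

/-- **`W₀(ℂ)[2] = {0, T₁, T₂, T₃}`** for a curve with split rational `2`-torsion and a modular parametrisation datum (used for `|W₀(ℂ)[2]| ≤ 4`).
[cite: SilvermanAEC2009, Prop. X.1.4] -/
theorem twoTorsion_subset_fourSet {e₁ e₂ e₃ : ℚ} (hC : (W₀.baseChange ℂ).toAffine.SplitTwoTorsion (e₁ : ℂ) (e₂ : ℂ) (e₃ : ℂ))
    (D₀ : ModularParametrizationData W₀ N) (S : (W₀.baseChange ℂ).toAffine.Point) (hS : 2 • S = 0) :
    S = 0 ∨ S = .some _ _ (nonsingular_twoTorsion hC) ∨ S = .some _ _ (nonsingular_twoTorsion hC.swap₁₂) ∨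
      S = .some _ _ (nonsingular_twoTorsion hC.swap₂₃.swap₁₂) := by
  set T₁ : (W₀.baseChange ℂ).toAffine.Point := .some _ _ (nonsingular_twoTorsion hC) with hT₁
  set T₂ : (W₀.baseChange ℂ).toAffine.Point := .some _ _ (nonsingular_twoTorsion hC.swap₁₂) with hT₂
  set T₃ : (W₀.baseChange ℂ).toAffine.Point := .some _ _ (nonsingular_twoTorsion hC.swap₂₃.swap₁₂) with hT₃
  have h2T : ∀ {a b c : ℂ} (h : (W₀.baseChange ℂ).toAffine.SplitTwoTorsion a b c),
      (2 : ℕ) • (Affine.Point.some _ _ (nonsingular_twoTorsion h) : (W₀.baseChange ℂ).toAffine.Point) = 0 := by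
    intro a b c h; rw [two_nsmul]; exact twoTorsion_add_self h
  have hT₂₁ : T₂ ≠ T₁ := fun h ↦ hC.ne₁₂ (by rw [hT₂, hT₁, Affine.Point.some.injEq] at h; exact h.1.symm)
  have hT₃₁ : T₃ ≠ T₁ := fun h ↦ hC.ne₁₃ (by rw [hT₃, hT₁, Affine.Point.some.injEq] at h; exact h.1.symm)
  have hT₃₂ : T₃ ≠ T₂ := fun h ↦ hC.ne₂₃ (by rw [hT₃, hT₂, Affine.Point.some.injEq] at h; exact h.1.symm)
  have hsub : ({0, T₁, T₂, T₃} : Set (W₀.baseChange ℂ).toAffine.Point) ⊆ {S | 2 • S = 0} := by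
    intro P hP
    simp only [Set.mem_insert_iff, Set.mem_singleton_iff] at hP
    rcases hP with rfl | rfl | rfl | rfl
    · exact (nsmul_zero 2 : (2 : ℕ) • (0 : (W₀.baseChange ℂ).toAffine.Point) = 0)
    · exact h2T hC
    · exact h2T hC.swap₁₂
    · exact h2T hC.swap₂₃.swap₁₂
  have hcard : ({0, T₁, T₂, T₃} : Set (W₀.baseChange ℂ).toAffine.Point).ncard = 4 := by
    rw [Set.ncard_insert_of_notMem (by
          simp only [Set.mem_insert_iff, Set.mem_singleton_iff, not_or]
          exact ⟨(Affine.Point.some_ne_zero _).symm, (Affine.Point.some_ne_zero _).symm, (Affine.Point.some_ne_zero _).symm⟩),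
      Set.ncard_insert_of_notMem (by
          simp only [Set.mem_insert_iff, Set.mem_singleton_iff, not_or]
          exact ⟨hT₂₁.symm, hT₃₁.symm⟩),
      Set.ncard_pair hT₃₂.symm]
  obtain ⟨hfin, hle⟩ := StepTwo.ncard_twoTorsion_le_four D₀
  have heq : ({0, T₁, T₂, T₃} : Set (W₀.baseChange ℂ).toAffine.Point) = {S | 2 • S = 0} :=
    Set.eq_of_subset_of_ncard_le hsub (by rw [hcard]; exact hle) hfin
  have hS' : S ∈ ({0, T₁, T₂, T₃} : Set (W₀.baseChange ℂ).toAffine.Point) := by rw [heq]; exact hS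
  simpa only [Set.mem_insert_iff, Set.mem_singleton_iff] using hS'

/-- Every `2`-torsion point of `W₀(ℂ)` is fixed by `Aut(ℂ/ℚ)` (split rational `2`-torsion). [cite: SilvermanAEC2009, Prop. X.1.4] -/
theorem twoTorsion_fixed {e₁ e₂ e₃ : ℚ} (hC : (W₀.baseChange ℂ).toAffine.SplitTwoTorsion (e₁ : ℂ) (e₂ : ℂ) (e₃ : ℂ))
    (D₀ : ModularParametrizationData W₀ N) (S : (W₀.baseChange ℂ).toAffine.Point) (hS : 2 • S = 0) (σ : ℂ ≃ₐ[ℚ] ℂ) :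
    Affine.Point.map (W' := W₀) (σ : ℂ →ₐ[ℚ] ℂ) S = S := by
  rcases twoTorsion_subset_fourSet hC D₀ S hS with rfl | rfl | rfl | rfl
  · exact _root_.map_zero _
  · exact map_twoTorsionPoint hC σ
  · exact map_twoTorsionPoint hC.swap₁₂ σ
  · exact map_twoTorsionPoint hC.swap₂₃.swap₁₂ σ

/-! ## §3 E-es-185 modulo the printed facts -/

/-- **E-es-185 `IndexFourForcesFreyTwistShape` ⟸ F★ ∧ CES ∧ T-es-75 ∧ the X₀ cusp fact.**  In the index-`4` configuration `Λ₁(f) = 2Λ₀(f)` of a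
lattice-optimal `X₀(N)`-datum of a globally minimal `W₀/ℚ`: `2⁵ ∣ N` and `W₀ ≅ y² = x(x − 2s²)(x − t²)`, `s` even, `t` odd.  See the module
docstring for the assembly; CONDITIONAL on the four printed facts; Manin's conjecture and BSD are not proved.
[cite: Stevens1982, §1.3 Thm. 1.3.1] [cite: Stevens1989, §2] [cite: ConradEdixhovenStein2003, §6.1.2 and Lemma 6.1.6] -/
theorem indexFourForcesFreyTwistShape_of_printedFacts (hF : optimalGamma1Parametrization_cusp_rational)
    (hCES : exists_optimal_gamma1ParametrizationData) (hSt : optimalGamma1Parametrization_cuspInv_galoisAction)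
    (hG : optimalParametrization_cusp_cyclotomic_galois) : IndexFourForcesFreyTwistShape := by
  intro W₀ _ _ N _ D₀ hopt h4
  -- D1: three rational `2`-torsion abscissae, sorted, and the split `2`-torsion
  obtain ⟨W₁, _, _, D₁, hiso, hD₁⟩ := hCES W₀ D₀ hopt
  have hf : D₁.f = D₀.f := D₁.f_eq_of_isIsogenous D₀ hiso
  obtain ⟨x₁, x₂, x₃, h12, h13, h23, hx₁, hx₂, hx₃⟩ :=
    IndexFourTwoTorsion.exists_three_rationalTwoTorsionX_of_index_four hF D₁ D₀ hD₁ hopt hf (by rw [hf]; exact h4)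
  obtain ⟨e₁, e₂, e₃, he₁₂, he₂₃, he₁, he₂, he₃⟩ := exists_sorted_twoTorsionX h12 h13 h23 hx₁ hx₂ hx₃
  have he₁₃ : e₁ < e₃ := he₁₂.trans he₂₃
  have hsplit : W₀.toAffine.SplitTwoTorsion e₁ e₂ e₃ :=
    TwoTorsionNormalForm.splitTwoTorsion_of_three_twoTorsionX he₁₂.ne he₁₃.ne he₂₃.ne he₁ he₂ he₃
  have hC := HalvingCocycle.splitTwoTorsion_complex hsplit
  -- the Legendre model `y² = x(x − A)(x − B)`, `A = e₂ − e₁`, `B = e₃ − e₁`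
  obtain ⟨C, hCW⟩ := TwoTorsionNormalForm.exists_variableChange_eq_legendre W₀ he₁₂.ne he₁₃.ne he₂₃.ne he₁ he₂ he₃
  have hA : (e₂ - e₁) ≠ 0 := sub_ne_zero.mpr he₁₂.ne'
  have hB : (e₃ - e₁) ≠ 0 := sub_ne_zero.mpr he₁₃.ne'
  have hAB : (e₂ - e₁) ≠ (e₃ - e₁) := fun h ↦ he₂₃.ne (by linarith)
  -- the `2`-torsion points over `ℂ`
  set T₁ : (W₀.baseChange ℂ).toAffine.Point := .some _ _ (nonsingular_twoTorsion hC) with hT₁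
  set T₂ : (W₀.baseChange ℂ).toAffine.Point := .some _ _ (nonsingular_twoTorsion hC.swap₁₂) with hT₂
  set T₃ : (W₀.baseChange ℂ).toAffine.Point := .some _ _ (nonsingular_twoTorsion hC.swap₂₃.swap₁₂) with hT₃
  have hT₁0 : T₁ ≠ 0 := Affine.Point.some_ne_zero _
  have hT₂0 : T₂ ≠ 0 := Affine.Point.some_ne_zero _
  have hT₂₁ : T₂ ≠ T₁ := fun h ↦ hC.ne₁₂ (by rw [hT₂, hT₁, Affine.Point.some.injEq] at h; exact h.1.symm)
  have h2T₁ : (2 : ℕ) • T₁ = 0 := by rw [two_nsmul]; exact twoTorsion_add_self hC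
  have h2T₂ : (2 : ℕ) • T₂ = 0 := by rw [two_nsmul]; exact twoTorsion_add_self hC.swap₁₂
  -- D4: the halving cocycles of `T₁`, `T₂`
  obtain ⟨Q₁, w₁, w₂, h2Q₁, hw₁, hw₂, hw₁0, hw₂0, htab₁⟩ := HalvingCocycle.exists_halvingCocycle_T₁ hC
  obtain ⟨Q₂, w₁', w₂', h2Q₂, hw₁', hw₂', hw₁0', hw₂0', htab₂⟩ := HalvingCocycle.exists_halvingCocycle_T₂ hC
  have h2Q₁' : 2 • Q₁ = T₁ := by rw [two_nsmul]; exact h2Q₁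
  have h2Q₂' : 2 • Q₂ = T₂ := by rw [two_nsmul]; exact h2Q₂
  have h4Q₁ : 2 • (2 • Q₁) = 0 := by rw [h2Q₁']; exact h2T₁
  have h4Q₂ : 2 • (2 • Q₂) = 0 := by rw [h2Q₂']; exact h2T₂
  -- signs of the descent pairs: `δ₁ > 0 > δ₂` for both
  have hδ₁pos : (0 : ℚ) < (e₁ - e₂) * (e₁ - e₃) := mul_pos_of_neg_of_neg (by linarith) (by linarith)
  have hδ₂neg : e₁ - e₂ < (0 : ℚ) := by linarith
  have hδ₁pos' : (0 : ℚ) < e₂ - e₁ := by linarith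
  have hδ₂neg' : (e₂ - e₁) * (e₂ - e₃) < (0 : ℚ) := mul_neg_of_pos_of_neg (by linarith) (by linarith)
  -- the two Kummer classes and their oddness: value `T₁` at complex conjugation
  set κ₁ : (ℂ ≃ₐ[ℚ] ℂ) → (W₀.baseChange ℂ).toAffine.Point := fun σ ↦ Affine.Point.map (W' := W₀) (σ : ℂ →ₐ[ℚ] ℂ) Q₁ - Q₁ with hκ₁
  set κ₂ : (ℂ ≃ₐ[ℚ] ℂ) → (W₀.baseChange ℂ).toAffine.Point := fun σ ↦ Affine.Point.map (W' := W₀) (σ : ℂ →ₐ[ℚ] ℂ) Q₂ - Q₂ with hκ₂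
  have htab₁' : ∀ σ : ℂ ≃ₐ[ℚ] ℂ, (κ₁ σ = 0 ∨ κ₁ σ = T₁ ∨ κ₁ σ = T₂ ∨ κ₁ σ = T₃) ∧ (σ w₁ = w₁ ↔ (κ₁ σ = 0 ∨ κ₁ σ = T₁)) ∧
      (σ w₂ = w₂ ↔ (κ₁ σ = 0 ∨ κ₁ σ = T₂)) := htab₁
  have htab₂' : ∀ σ : ℂ ≃ₐ[ℚ] ℂ, (κ₂ σ = 0 ∨ κ₂ σ = T₁ ∨ κ₂ σ = T₂ ∨ κ₂ σ = T₃) ∧ (σ w₁' = w₁' ↔ (κ₂ σ = 0 ∨ κ₂ σ = T₁)) ∧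
      (σ w₂' = w₂' ↔ (κ₂ σ = 0 ∨ κ₂ σ = T₂)) := htab₂
  have hodd₁ : κ₁ (Complex.conjAe.restrictScalars ℚ) = T₁ := DescentDictionary.cocycle_conj_eq κ₁ hδ₁pos hδ₂neg hw₁ hw₂ htab₁'
  have hodd₂ : κ₂ (Complex.conjAe.restrictScalars ℚ) = T₁ := DescentDictionary.cocycle_conj_eq κ₂ hδ₁pos' hδ₂neg' hw₁' hw₂' htab₂'
  -- every `2`-torsion point is fixed (D1, no `4 ∣ N`)
  have h2fix : ∀ S : (W₀.baseChange ℂ).toAffine.Point, 2 • S = 0 → ∀ σ : ℂ ≃ₐ[ℚ] ℂ,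
      Affine.Point.map (W' := W₀) (σ : ℂ →ₐ[ℚ] ℂ) S = S := fun S hS σ ↦ twoTorsion_fixed hC D₀ S hS σ
  -- the Kummer subgroup (LEAD `exists_kummerSubgroup_cuspHalves_of_fixed`; D3 rationality of `R_y` ⟸ the X₀ cusp fact)
  obtain ⟨𝒱, h𝒱fin, h𝒱card, hmemR, hmem2⟩ := KummerSubgroup.exists_kummerSubgroup_cuspHalves_of_fixed D₀ h2fix
    (fun Q y hQy hcop σ ↦ by
      obtain ⟨P₀, hP₀⟩ := uniformize_modularSymbol_inv_unitary_rational hG D₀ hopt Q y hQy hcop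
      rw [← hP₀]; exact Affine.Point.map_baseChange (W' := W₀) (σ : ℂ →ₐ[ℚ] ℂ) P₀)
  -- PROPOSITION A (p2 `propositionA_complex`) with THEOREM K (es `indexFour_kummerDiamondReciprocity`) and the odd class `κ₁`
  obtain ⟨h32, p, a, b, y₂, yp, v, h₁, h₂, hp, hp2, hp4, ha5, hb1, hNa, -, hNp, -, hv0, -, -, -, -, hc₁, hc₂, -,
      hoddmem, -, -, h₂sq, h₂val, h₁mod8, h₁onto⟩ :=
    StepTwo.propositionA_complex D₀ hopt h4 𝒱 h𝒱fin h𝒱card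
      (fun Q y hQy hcop ↦ ⟨_, hmemR Q y hQy hcop, fun σ d d' hdd' hσ γ hγQ hγy ↦ by
        show Affine.Point.map (W' := W₀) (σ : ℂ →ₐ[ℚ] ℂ) (D₀.uniformize ((D₀.c : ℂ) * modularSymbol D₀.f (1 / (y : ℚ)) / 2)) -
            D₀.uniformize ((D₀.c : ℂ) * modularSymbol D₀.f (1 / (y : ℚ)) / 2) = D₀.uniformize ((D₀.c : ℂ) * cuspSymbol D₀.f γ / 2)
        rw [indexFour_kummerDiamondReciprocity hSt hCES W₀ D₀ hopt h4 σ d d' hdd' hσ Q y hQy hcop γ hγQ hγy, add_sub_cancel_left]⟩)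
      ⟨κ₁, hmem2 Q₁ h4Q₁, by rw [hodd₁]; exact hT₁0⟩
  refine ⟨h32, ?_⟩
  have h8 : 8 ∣ N := ⟨2 ^ (a - 3) * y₂, by
    rw [← hNa, show (8 : ℕ) = 2 ^ 3 by norm_num, ← mul_assoc, ← pow_add, Nat.add_sub_cancel' (by omega : 3 ≤ a)]⟩
  have hpN : p ∣ N := ⟨p ^ (b - 1) * yp, by
    rw [← hNp, ← mul_assoc, ← pow_succ', Nat.sub_add_cancel hb1]⟩
  -- membership of the two classes: each is `h₁` or `h₂`, and `v = T₁`
  have hκ₁mem : κ₁ = h₁ ∨ κ₁ = h₂ := hoddmem κ₁ (hmem2 Q₁ h4Q₁) (by rw [hodd₁]; exact hT₁0)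
  have hκ₂mem : κ₂ = h₁ ∨ κ₂ = h₂ := hoddmem κ₂ (hmem2 Q₂ h4Q₂) (by rw [hodd₂]; exact hT₁0)
  have hv : v = T₁ := by
    rcases hκ₁mem with h | h
    · rw [← hc₁, ← h]; exact hodd₁
    · rw [← hc₂, ← h]; exact hodd₁
  -- `κ(1) = 0` from the sign table (`1` fixes `w₁` and `w₂`)
  have hone : ∀ (κ : (ℂ ≃ₐ[ℚ] ℂ) → (W₀.baseChange ℂ).toAffine.Point) {u₁ u₂ : ℂ},
      (∀ σ : ℂ ≃ₐ[ℚ] ℂ, (κ σ = 0 ∨ κ σ = T₁ ∨ κ σ = T₂ ∨ κ σ = T₃) ∧ (σ u₁ = u₁ ↔ (κ σ = 0 ∨ κ σ = T₁)) ∧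
        (σ u₂ = u₂ ↔ (κ σ = 0 ∨ κ σ = T₂))) → κ 1 = 0 := by
    intro κ u₁ u₂ htab
    obtain ⟨-, t₁, t₂⟩ := htab 1
    rcases t₁.mp (AlgEquiv.one_apply u₁) with h | h
    · exact h
    · rcases t₂.mp (AlgEquiv.one_apply u₂) with h' | h'
      · exact h'
      · exact absurd (h.symm.trans h') hT₂₁.symm
  have hpQ : (-(p : ℚ)) ≠ 0 := neg_ne_zero.mpr (by exact_mod_cast hp.ne_zero)
  -- the common second coordinate of `h₁`: `−1` or `−2`
  -- reading of a class equal to `h₂`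
  have read₂ : ∀ (κ : (ℂ ≃ₐ[ℚ] ℂ) → (W₀.baseChange ℂ).toAffine.Point) {δ₁ δ₂ : ℚ}, δ₁ ≠ 0 → δ₂ ≠ 0 → ∀ {u₁ u₂ : ℂ},
      u₁ ^ 2 = (δ₁ : ℂ) → u₂ ^ 2 = (δ₂ : ℂ) →
      (∀ σ : ℂ ≃ₐ[ℚ] ℂ, (κ σ = 0 ∨ κ σ = T₁ ∨ κ σ = T₂ ∨ κ σ = T₃) ∧ (σ u₁ = u₁ ↔ (κ σ = 0 ∨ κ σ = T₁)) ∧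
        (σ u₂ = u₂ ↔ (κ σ = 0 ∨ κ σ = T₂))) →
      κ = h₂ → sqClass δ₁ = 1 ∧ sqClass δ₂ = sqClass (-(p : ℚ)) := by
    intro κ δ₁ δ₂ hδ₁ hδ₂ u₁ u₂ hu₁ hu₂ htab hκ
    rw [hκ] at htab
    refine DescentDictionary.reading_of_h₂ (N := N) hp hp4 hpN hT₂0 hT₂₁ h₂ hδ₂ hu₁ hu₂ (fun σ ↦ (htab σ).2.1)
      (fun σ ↦ (htab σ).2.2) (fun σ ↦ ?_) h₂sq
    rcases h₂val σ with h | h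
    · exact Or.inl h
    · exact Or.inr (h.trans hv)
  -- reading of a class equal to `h₁`, with a chosen `σ₂`
  have read₁ : ∀ (κ : (ℂ ≃ₐ[ℚ] ℂ) → (W₀.baseChange ℂ).toAffine.Point) {δ₁ δ₂ : ℚ}, δ₁ ≠ 0 → δ₂ ≠ 0 → ∀ {u₁ u₂ : ℂ},
      u₁ ^ 2 = (δ₁ : ℂ) → u₂ ^ 2 = (δ₂ : ℂ) →
      (∀ σ : ℂ ≃ₐ[ℚ] ℂ, (κ σ = 0 ∨ κ σ = T₁ ∨ κ σ = T₂ ∨ κ σ = T₃) ∧ (σ u₁ = u₁ ↔ (κ σ = 0 ∨ κ σ = T₁)) ∧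
        (σ u₂ = u₂ ↔ (κ σ = 0 ∨ κ σ = T₂))) →
      κ 1 = 0 → κ (Complex.conjAe.restrictScalars ℚ) = T₁ → κ = h₁ →
      ∃ (σ₂ : ℂ ≃ₐ[ℚ] ℂ) (d₂ d₂' : ℤ), ((d₂ * d₂' : ℤ) : ZMod N) = 1 ∧
        σ₂ (exp (2 * Real.pi * I / N)) = exp (2 * Real.pi * I * d₂ / N) ∧ h₁ σ₂ = T₂ ∧
        ((d₂ : ZMod 8) = 3 ∨ (d₂ : ZMod 8) = 5) ∧
        sqClass δ₁ = sqClass (2 : ℚ) ∧ ((d₂ : ZMod 8) = 5 → sqClass δ₂ = sqClass (-1 : ℚ)) ∧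
          ((d₂ : ZMod 8) = 3 → sqClass δ₂ = sqClass (-2 : ℚ)) := by
    intro κ δ₁ δ₂ hδ₁ hδ₂ u₁ u₂ hu₁ hu₂ htab hκ1 hκc hκ
    rw [hκ] at htab hκ1 hκc
    obtain ⟨σ₂, hσ₂⟩ := DescentDictionary.exists_hit_T₂ h₁ _ (StepTwo.four_le_ncard_range_uniformize_half_cuspSymbol D₀ hopt) h₁onto
      (fun σ ↦ (htab σ).1)
    obtain ⟨d₂, d₂', hdd₂, hσ₂'⟩ := StepTwo.exists_inv_pair_of_algEquiv (N := N) σ₂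
    have hres := DescentDictionary.residue_of_T₂ (N := N) h8 hT₂0 hT₂₁ h₁ h₁mod8 hκ1 hκc hdd₂ hσ₂' hσ₂
    obtain ⟨r₁, r₅, r₃⟩ := DescentDictionary.reading_of_h₁ (N := N) h8 h₁ hδ₁ hδ₂ hu₁ hu₂ (fun σ ↦ (htab σ).2.1)
      (fun σ ↦ (htab σ).2.2) h₁mod8 hκ1 hκc hdd₂ hσ₂' hσ₂
    exact ⟨σ₂, d₂, d₂', hdd₂, hσ₂', hσ₂, hres, r₁, r₅, r₃⟩
  -- the square-class identities `δ(T₁) = (AB, −A)`, `δ(T₂) = (A, A(A−B))`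
  have eAB : (e₂ - e₁) * (e₃ - e₁) = (e₁ - e₂) * (e₁ - e₃) := by ring
  have enA : -(e₂ - e₁) = e₁ - e₂ := by ring
  have eAAB : (e₂ - e₁) * ((e₂ - e₁) - (e₃ - e₁)) = (e₂ - e₁) * (e₂ - e₃) := by ring
  have hδ₁ : (e₁ - e₂) * (e₁ - e₃) ≠ 0 := hδ₁pos.ne'
  have hδ₂ : e₁ - e₂ ≠ 0 := hδ₂neg.ne
  have hδ₁' : e₂ - e₁ ≠ 0 := hδ₁pos'.ne'
  have hδ₂' : (e₂ - e₁) * (e₂ - e₃) ≠ 0 := hδ₂neg'.ne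
  -- choose the common `δ` and conclude by D7
  by_cases H : ∃ (σ : ℂ ≃ₐ[ℚ] ℂ) (d d' : ℤ), ((d * d' : ℤ) : ZMod N) = 1 ∧
      σ (exp (2 * Real.pi * I / N)) = exp (2 * Real.pi * I * d / N) ∧ h₁ σ = T₂ ∧ (d : ZMod 8) = 5
  · -- `δ = [−1]`
    obtain ⟨σ₅, d₅, d₅', hdd₅, hσ₅, hκ₅, h5⟩ := H
    have key : ∀ (κ : (ℂ ≃ₐ[ℚ] ℂ) → (W₀.baseChange ℂ).toAffine.Point) {δ₁ δ₂ : ℚ}, δ₁ ≠ 0 → δ₂ ≠ 0 → ∀ {u₁ u₂ : ℂ},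
        u₁ ^ 2 = (δ₁ : ℂ) → u₂ ^ 2 = (δ₂ : ℂ) →
        (∀ σ : ℂ ≃ₐ[ℚ] ℂ, (κ σ = 0 ∨ κ σ = T₁ ∨ κ σ = T₂ ∨ κ σ = T₃) ∧ (σ u₁ = u₁ ↔ (κ σ = 0 ∨ κ σ = T₁)) ∧
          (σ u₂ = u₂ ↔ (κ σ = 0 ∨ κ σ = T₂))) →
        κ 1 = 0 → κ (Complex.conjAe.restrictScalars ℚ) = T₁ → (κ = h₁ ∨ κ = h₂) →
        (sqClass δ₁ = sqClass (2 : ℚ) ∧ sqClass δ₂ = sqClass (-1 : ℚ)) ∨ (sqClass δ₁ = 1 ∧ sqClass δ₂ = sqClass (-(p : ℚ))) := by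
      intro κ δ₁ δ₂ hδ₁ hδ₂ u₁ u₂ hu₁ hu₂ htab hκ1 hκc hκ
      rcases hκ with hκ | hκ
      · left
        rw [hκ] at htab hκ1 hκc
        obtain ⟨r₁, r₅, -⟩ := DescentDictionary.reading_of_h₁ (N := N) h8 h₁ hδ₁ hδ₂ hu₁ hu₂ (fun σ ↦ (htab σ).2.1)
          (fun σ ↦ (htab σ).2.2) h₁mod8 hκ1 hκc hdd₅ hσ₅ hκ₅
        exact ⟨r₁, r₅ h5⟩
      · right; exact read₂ κ hδ₁ hδ₂ hu₁ hu₂ htab hκ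
    have k₁ := key κ₁ hδ₁ hδ₂ hw₁ hw₂ htab₁' (hone κ₁ htab₁') hodd₁ hκ₁mem
    have k₂ := key κ₂ hδ₁' hδ₂' hw₁' hw₂' htab₂' (hone κ₂ htab₂') hodd₂ hκ₂mem
    refine KummerDiamondCases.hasFreyTwistShape_of_legendre_descent_cases W₀ hCW hA hB hAB hp hp4 (sqClass (-1 : ℚ)) ?_ ?_
    · rw [eAB, enA]; exact k₁
    · rw [eAAB]; exact k₂
  · -- `δ = [−2]`
    have key : ∀ (κ : (ℂ ≃ₐ[ℚ] ℂ) → (W₀.baseChange ℂ).toAffine.Point) {δ₁ δ₂ : ℚ}, δ₁ ≠ 0 → δ₂ ≠ 0 → ∀ {u₁ u₂ : ℂ},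
        u₁ ^ 2 = (δ₁ : ℂ) → u₂ ^ 2 = (δ₂ : ℂ) →
        (∀ σ : ℂ ≃ₐ[ℚ] ℂ, (κ σ = 0 ∨ κ σ = T₁ ∨ κ σ = T₂ ∨ κ σ = T₃) ∧ (σ u₁ = u₁ ↔ (κ σ = 0 ∨ κ σ = T₁)) ∧
          (σ u₂ = u₂ ↔ (κ σ = 0 ∨ κ σ = T₂))) →
        κ 1 = 0 → κ (Complex.conjAe.restrictScalars ℚ) = T₁ → (κ = h₁ ∨ κ = h₂) →
        (sqClass δ₁ = sqClass (2 : ℚ) ∧ sqClass δ₂ = sqClass (-2 : ℚ)) ∨ (sqClass δ₁ = 1 ∧ sqClass δ₂ = sqClass (-(p : ℚ))) := by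
      intro κ δ₁ δ₂ hδ₁ hδ₂ u₁ u₂ hu₁ hu₂ htab hκ1 hκc hκ
      rcases hκ with hκ | hκ
      · left
        obtain ⟨σ₂, d₂, d₂', hdd₂, hσ₂', hσ₂, hres, r₁, -, r₃⟩ := read₁ κ hδ₁ hδ₂ hu₁ hu₂ htab hκ1 hκc hκ
        have h3 : (d₂ : ZMod 8) = 3 := by
          rcases hres with h | h
          · exact h
          · exact absurd ⟨σ₂, d₂, d₂', hdd₂, hσ₂', hσ₂, h⟩ H
        exact ⟨r₁, r₃ h3⟩
      · right; exact read₂ κ hδ₁ hδ₂ hu₁ hu₂ htab hκ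
    have k₁ := key κ₁ hδ₁ hδ₂ hw₁ hw₂ htab₁' (hone κ₁ htab₁') hodd₁ hκ₁mem
    have k₂ := key κ₂ hδ₁' hδ₂' hw₁' hw₂' htab₂' (hone κ₂ htab₂') hodd₂ hκ₂mem
    refine KummerDiamondCases.hasFreyTwistShape_of_legendre_descent_cases W₀ hCW hA hB hAB hp hp4 (sqClass (-2 : ℚ)) ?_ ?_
    · rw [eAB, enA]; exact k₁
    · rw [eAAB]; exact k₂

end Summit.BirchSwinnertonDyer.BirchSwinnertonDyer.Theorems.ManinLocalTwoThree.KummerDiamondIndexFour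

end
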